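import Literature.AlgebraicGeometry.Motives.KaehlerFormPowFrameProofs
import Literature.Geometry.Kaehler.TwoPowPairFrame
import Literature.NumberTheory.Transcendental.FormIntegrationCharts
import Literature.NumberTheory.Transcendental.FormIntegrationPositivity
import Literature.NumberTheory.Transcendental.FormIntegrationStokes
import Literature.NumberTheory.Transcendental.FormsAlgebraWedgeAssocProofs
import Literature.NumberTheory.Transcendental.FormsAlgebraWedgeCommProofs
import Literature.Geometry.Kaehler.TwoFormPowers
import Mathlib.RingTheory.Norm.Transitivity
import Mathlib.RingTheory.Complex
import Mathlib.LinearAlgebra.Complex.FiniteDimensional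
import HarnessLib

/-!
# Top powers of semi-positive `(1,1)`-forms: non-negativity on complex frames and `∫_M θⁿ > 0`

Layer `Literature/Geometry/Kaehler`. Theorems-only companion (no definitions, no named facts;
D-0026) of `TwoFormPowers` (`ContinuousAlternatingMap.twoPow`, `MForm.twoFormPow`: the wedge powers
of an ARBITRARY `2`-form), `TwoPowPairFrame` (Voisin's (3.2) on weighted complex frames) and
`AlgebraicGeometry/Motives/KaehlerVolumePositivityProofs` (`∫_M ωⁿ > 0` for the Kähler form of a
Hermitian METRIC). Here the `2`-form is only SEMI-positive — the situation of the pull-back `f^*ω` of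
a Kähler form along a holomorphic map `f` which need not be an immersion (Wirtinger: the volume of the
image counted with multiplicity) — and positivity of the integral is obtained from positivity at ONE
point:

* `TwoForm.continuous_twoPow_apply` — `A ↦ Aʳ(v)` is continuous in the `2`-covector `A`;
* `TwoForm.exists_basis_twoPow_apply_eq_factorial`, `TwoForm.twoPow_apply_basisFrame_pos` — for a
  real `2`-covector `A` on a complex space `V` which is `J`-invariant and POSITIVE
  (`A(v, iv) > 0`, `v ≠ 0`): `Aⁿ = n!` on a unitary frame (`exists_basis_unitary` for the form
  `B(v, w) = A(v, iw)`, and (3.2) `twoPow_apply_complexPairFrame`), hence `Aⁿ > 0` on the interleaved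
  frame `(e₀, ie₀, …)` of EVERY complex basis `e` (change of frame by a complex-linear automorphism,
  real determinant `|det_ℂ|² > 0`; Voisin I Lemma 3.8, Huybrechts Cor. 1.2.3);
* `TwoForm.twoPow_apply_basisFrame_nonneg` — for `A` `J`-invariant and SEMI-positive
  (`A(v, iv) ≥ 0`), `Aⁿ ≥ 0` on every complex frame, as soon as `V` carries some positive
  `J`-invariant covector `C` (`A + εC` is positive, let `ε → 0⁺`);
* `exists_orientation_integral_twoFormPow_pos` — **on a compact complex manifold `M` of dimension
  `n`, a smooth `2`-form `θ` which is pointwise `J`-invariant and semi-positive, and positive at one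
  point `x₀`, has `0 < ∫_M θⁿ`** for the constant (complex) orientation `[θⁿ_{x₀}]` of the model
  space: `θⁿ_x = c(x) θⁿ_{x₀}`, `c ≥ 0`, `c(x₀) = 1`, and `MForm.integral_pos_of_sign_mul_apply_nonneg`
  (Lee Prop. 16.6 (c));
* `twoFormPow_finrank_not_mem_exactSmoothForms` — hence `θⁿ` is not exact (Stokes,
  `MForm.integral_eq_zero_of_mem_exactSmoothForms_holds`), i.e. `[θ]ⁿ ≠ 0` in `H^{2n}_dR(M)` for
  `θ` closed.

Consumer: the non-vanishing of the fundamental class of a subvariety of a smooth projective variety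
(`HodgeTheory/AlgebraicClassesHodgeType`, fact `map_fundamentalClass_ne_zero_of_height_eq`), through
the restricted Fubini–Study form `θ_{τ ≫ κ} = (τ^an)^* θ_κ` of a generically immersive morphism `τ`.

## References

* [VoisinHodgeI2002] C. Voisin, Hodge Theory and Complex Algebraic Geometry I (CUP 2002), §3.1.3
  Lemma 3.8 with eq. (3.2), Cor. 3.9, p. 64.
* [Huybrechts2005] D. Huybrechts, Complex Geometry (Springer 2005), Cor. 1.2.3, Exercise 1.2.9
  (Wirtinger inequality).
* [LeeSmoothManifolds2013] J. M. Lee, Introduction to Smooth Manifolds, 2nd ed. (2013),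
  Prop. 16.6 (c), Cor. 16.13.
* [WarnerGTM94] F. W. Warner, Foundations of Differentiable Manifolds and Lie Groups (1983), 2.6,
  2.17.
-/

noncomputable section

open Module

namespace Literature.Geometry.Kaehler

namespace TwoForm

variable {V : Type*} [NormedAddCommGroup V] [NormedSpace ℂ V] [FiniteDimensional ℂ V]

/-! ### Continuity of `A ↦ Aʳ(v)` -/

omit [FiniteDimensional ℂ V] in
/-- The value `Aʳ(v)` of the `r`-th wedge power on a fixed frame depends continuously on the
`2`-covector `A` (it is a polynomial in the values of `A`: the subset-shuffle formula
`wedge_apply_eq_sum_powersetCard`). [cite: WarnerGTM94, 2.6] -/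
theorem continuous_twoPow_apply (r : ℕ) (v : Fin (2 * r) → V) :
    Continuous fun A : V [⋀^Fin 2]→L[ℝ] ℝ ↦ A.twoPow r v := by
  induction r with
  | zero => exact continuous_const
  | succ r ih =>
    simp_rw [ContinuousAlternatingMap.twoPow_succ, ContinuousAlternatingMap.domDomCongr_apply,
      wedge_apply_eq_sum_powersetCard]
    refine continuous_finsetSum _ fun s _ ↦ ?_
    exact ((ih _).mul (continuous_eval_const _)).const_smul _

/-! ### The interleaved frame of a complex basis and positive `(1,1)`-covectors -/

/-- **A positive `(1,1)`-covector has `n!` as top power on a unitary frame.** Let `A` be a real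
`2`-covector on the complex space `V` (`n = dim_ℂ V`) which is `J`-invariant (`A(iv, iw) = A(v, w)`)
and positive (`A(v, iv) > 0` for `v ≠ 0`), i.e. the Kähler form `ω = g(J·, ·)`-type covector of the
positive definite `J`-invariant symmetric form `B(v, w) = A(v, iw)`. Then for a `B`-unitary complex
basis `b` (`exists_basis_unitary`), `Aⁿ(b₀, ib₀, …, b_{n-1}, ib_{n-1}) = n!` (Voisin I, Lemma 3.8
eq. (3.2), `twoPow_apply_complexPairFrame` with all weights `1`).
[cite: VoisinHodgeI2002, §3.1.3 Lemma 3.8 eq. (3.2)] -/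
theorem exists_basis_twoPow_apply_eq_factorial (A : V [⋀^Fin 2]→L[ℝ] ℝ)
    (hJ : ∀ v w, A ![Complex.I • v, Complex.I • w] = A ![v, w])
    (hpos : ∀ v, v ≠ 0 → 0 < A ![v, Complex.I • v]) :
    ∃ b : Module.Basis (Fin (finrank ℂ V)) ℂ V,
      A.twoPow (finrank ℂ V) (fun i : Fin (2 * finrank ℂ V) ↦
        if (i : ℕ) % 2 = 0 then b ⟨(i : ℕ) / 2, by omega⟩
          else Complex.I • b ⟨(i : ℕ) / 2, by omega⟩) = (finrank ℂ V).factorial := by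
  -- elementary identities for the `2`-covector `A`
  have hadd : ∀ u v w, A ![u + v, w] = A ![u, w] + A ![v, w] := fun u v w ↦ by
    have h := A.toAlternatingMap.map_vecCons_add ![w] u v
    simpa using h
  have hsmul : ∀ (a : ℝ) (v w : V), A ![(a : ℂ) • v, w] = a * A ![v, w] := fun a v w ↦ by
    have h := A.toAlternatingMap.map_vecCons_smul ![w] a v
    rw [Complex.coe_smul]
    simpa using h
  have hswap : ∀ v w, A ![v, w] = -A ![w, v] :=
    fun v w ↦ Literature.AlgebraicGeometry.Motives.apply_vecCons_two_swap A v w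
  have hII : ∀ v : V, Complex.I • (Complex.I • v) = -v := fun v ↦ by
    rw [smul_smul, Complex.I_mul_I, neg_one_smul]
  have hneg2 : ∀ v w, A ![v, -w] = -A ![v, w] := fun v w ↦ by
    rw [hswap v (-w), hswap v w, neg_neg]
    have h := hsmul (-1) w v
    rw [show ((-1 : ℝ) : ℂ) = -1 by norm_num, neg_one_smul] at h
    rw [h]
    ring
  -- the symmetric form `B(v, w) = A(v, iw)`
  have hBsymm : ∀ v w, A ![v, Complex.I • w] = A ![w, Complex.I • v] := fun v w ↦ by
    rw [← hJ v (Complex.I • w), hII, hneg2, hswap, neg_neg]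
  have hBJ : ∀ v w, A ![Complex.I • v, Complex.I • (Complex.I • w)] = A ![v, Complex.I • w] :=
    fun v w ↦ hJ v (Complex.I • w)
  obtain ⟨b, hb1, hb2⟩ := Literature.AlgebraicGeometry.Motives.exists_basis_unitary (F := V)
    (fun v w ↦ A ![v, Complex.I • w]) (fun u v w ↦ hadd u v _) (fun a v w ↦ hsmul a v _)
    hBsymm hpos hBJ
  refine ⟨b, ?_⟩
  -- the unitary frame as an `ℕ`-indexed sequence
  set u : ℕ → V := fun i ↦ if h : i < finrank ℂ V then b ⟨i, h⟩ else 0 with hu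
  have hui : ∀ (i : ℕ) (h : i < finrank ℂ V), u i = b ⟨i, h⟩ := fun i h ↦ by simp [hu, h]
  have key := twoPow_apply_complexPairFrame A (finrank ℂ V) u (fun _ ↦ 1) ?_ ?_ ?_
  · rw [Finset.prod_const_one, mul_one] at key
    rw [← key]
    congr 1
    funext i
    split_ifs with h
    · rw [hui _ (by omega)]
    · rw [hui _ (by omega)]
  · -- `A(bᵢ, bⱼ) = -B(bᵢ, i bⱼ)·… = 0`
    intro i j hi hj
    rw [hui i hi, hui j hj]
    have h1 : A ![b ⟨i, hi⟩, b ⟨j, hj⟩] =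
        -A ![b ⟨i, hi⟩, Complex.I • (Complex.I • b ⟨j, hj⟩)] := by
      rw [hII, hneg2, neg_neg]
    rw [h1, hBsymm, hb2, neg_zero]
  · intro i j hi hj
    rw [hui i hi, hui j hj, hJ]
    have h1 : A ![b ⟨i, hi⟩, b ⟨j, hj⟩] =
        -A ![b ⟨i, hi⟩, Complex.I • (Complex.I • b ⟨j, hj⟩)] := by
      rw [hII, hneg2, neg_neg]
    rw [h1, hBsymm, hb2, neg_zero]
  · intro i j hi hj
    rw [hui i hi, hui j hj, hb1]
    by_cases hij : i = j
    · subst hij; simp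
    · have : (⟨i, hi⟩ : Fin (finrank ℂ V)) ≠ ⟨j, hj⟩ := fun h ↦ hij (by simpa using h)
      simp [hij, this]

/-- **A positive `(1,1)`-covector has positive top power on EVERY complex frame**: with `A` as in
`exists_basis_twoPow_apply_eq_factorial` and `e` any complex basis of `V`,
`0 < Aⁿ(e₀, ie₀, …, e_{n-1}, ie_{n-1})` — the frame of `e` is the image of a unitary frame under a
complex-linear automorphism, whose real determinant `|det_ℂ|²` is positive (Huybrechts, Cor. 1.2.3:
complex vector spaces are canonically oriented; the computation of the tree's
`kaehlerFormPow_apply_basisFrame_pos`). [cite: Huybrechts2005, Cor. 1.2.3]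
[cite: VoisinHodgeI2002, §3.1.3 Lemma 3.8] -/
theorem twoPow_apply_basisFrame_pos (A : V [⋀^Fin 2]→L[ℝ] ℝ)
    (hJ : ∀ v w, A ![Complex.I • v, Complex.I • w] = A ![v, w])
    (hpos : ∀ v, v ≠ 0 → 0 < A ![v, Complex.I • v])
    (e : Module.Basis (Fin (finrank ℂ V)) ℂ V) :
    0 < A.twoPow (finrank ℂ V) (fun i : Fin (2 * finrank ℂ V) ↦
        if (i : ℕ) % 2 = 0 then e ⟨(i : ℕ) / 2, by omega⟩
          else Complex.I • e ⟨(i : ℕ) / 2, by omega⟩) := by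
  obtain ⟨b, hb⟩ := exists_basis_twoPow_apply_eq_factorial A hJ hpos
  set w : V [⋀^Fin (2 * finrank ℂ V)]→L[ℝ] ℝ := A.twoPow (finrank ℂ V) with hw
  obtain ⟨Fb, hFb⟩ : ∃ Fb : Fin (2 * finrank ℂ V) → V, Fb = fun i : Fin (2 * finrank ℂ V) ↦
      if (i : ℕ) % 2 = 0 then b ⟨(i : ℕ) / 2, by omega⟩
        else Complex.I • b ⟨(i : ℕ) / 2, by omega⟩ := ⟨_, rfl⟩
  obtain ⟨Fe, hFe⟩ : ∃ Fe : Fin (2 * finrank ℂ V) → V, Fe = fun i : Fin (2 * finrank ℂ V) ↦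
      if (i : ℕ) % 2 = 0 then e ⟨(i : ℕ) / 2, by omega⟩
        else Complex.I • e ⟨(i : ℕ) / 2, by omega⟩ := ⟨_, rfl⟩
  have hb' : w Fb = (finrank ℂ V).factorial := by rw [hFb]; exact hb
  suffices h : 0 < w Fe by rw [hFe] at h; exact h
  set L₀ : V ≃ₗ[ℂ] V := b.equiv e (Equiv.refl _) with hL₀
  have hLb₀ : ∀ i, L₀ (b i) = e i := fun i ↦ by rw [hL₀, Module.Basis.equiv_apply]; rfl
  set L : V →ₗ[ℝ] V := (L₀ : V →ₗ[ℂ] V).restrictScalars ℝ with hL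
  have hLb : ∀ i, L (b i) = e i := fun i ↦ by
    rw [hL, LinearMap.restrictScalars_apply, LinearEquiv.coe_coe, hLb₀]
  have hLIb : ∀ i, L (Complex.I • b i) = Complex.I • e i := fun i ↦ by
    rw [hL, LinearMap.restrictScalars_apply, LinearEquiv.coe_coe, map_smul, hLb₀]
  have hframe : Fe = fun i ↦ L (Fb i) := by
    rw [hFe, hFb]
    funext i
    dsimp only
    split_ifs
    · rw [hLb]
    · rw [hLIb]
  have hdet : 0 < LinearMap.det L := by
    rw [hL, LinearMap.det_restrictScalars, Algebra.norm_complex_apply]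
    exact Complex.normSq_pos.2 L₀.isUnit_det'.ne_zero
  obtain ⟨B₀⟩ : Nonempty (Module.Basis (Fin (2 * finrank ℂ V)) ℝ V) :=
    ⟨Module.finBasisOfFinrankEq ℝ V (finrank_real_of_complex V)⟩
  have key := Literature.NumberTheory.Transcendental.AlternatingMap.apply_linearMap_comp_eq_det_mul
    B₀ w.toAlternatingMap L Fb
  rw [ContinuousAlternatingMap.coe_toAlternatingMap] at key
  rw [hframe, key, hb']
  exact mul_pos hdet (by exact_mod_cast Nat.factorial_pos _)

/-- **A semi-positive `(1,1)`-covector has non-negative top power on every complex frame.** Let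
`A` be `J`-invariant with `A(v, iv) ≥ 0` for all `v`, and suppose `V` carries SOME positive
`J`-invariant `2`-covector `C` (e.g. the Kähler covector of a Hermitian inner product). Then
`0 ≤ Aⁿ(e₀, ie₀, …, e_{n-1}, ie_{n-1})` for every complex basis `e`: `A + εC` is positive for
`ε > 0`, so its top power is positive on the frame (`twoPow_apply_basisFrame_pos`), and
`ε ↦ (A + εC)ⁿ(frame)` is continuous (`continuous_twoPow_apply`). (The printed statement: a
semi-positive `(1,1)`-form `θ` has `θⁿ ≥ 0` with respect to the complex orientation; Demailly,
Ch. III §1.) [cite: VoisinHodgeI2002, §3.1.3 Lemma 3.8] [cite: Huybrechts2005, Cor. 1.2.3] -/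
theorem twoPow_apply_basisFrame_nonneg (A C : V [⋀^Fin 2]→L[ℝ] ℝ)
    (hJ : ∀ v w, A ![Complex.I • v, Complex.I • w] = A ![v, w])
    (hnn : ∀ v, 0 ≤ A ![v, Complex.I • v])
    (hCJ : ∀ v w, C ![Complex.I • v, Complex.I • w] = C ![v, w])
    (hCpos : ∀ v, v ≠ 0 → 0 < C ![v, Complex.I • v])
    (e : Module.Basis (Fin (finrank ℂ V)) ℂ V) :
    0 ≤ A.twoPow (finrank ℂ V) (fun i : Fin (2 * finrank ℂ V) ↦
        if (i : ℕ) % 2 = 0 then e ⟨(i : ℕ) / 2, by omega⟩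
          else Complex.I • e ⟨(i : ℕ) / 2, by omega⟩) := by
  set F : Fin (2 * finrank ℂ V) → V := fun i : Fin (2 * finrank ℂ V) ↦
    if (i : ℕ) % 2 = 0 then e ⟨(i : ℕ) / 2, by omega⟩
      else Complex.I • e ⟨(i : ℕ) / 2, by omega⟩ with hF
  set f : ℝ → ℝ := fun ε ↦ (A + ε • C).twoPow (finrank ℂ V) F with hf
  have hfpos : ∀ ε : ℝ, 0 < ε → 0 < f ε := by
    intro ε hε
    refine twoPow_apply_basisFrame_pos (A + ε • C) (fun v w ↦ ?_) (fun v hv ↦ ?_) e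
    · simp only [ContinuousAlternatingMap.add_apply, ContinuousAlternatingMap.smul_apply, hJ, hCJ]
    · simp only [ContinuousAlternatingMap.add_apply, ContinuousAlternatingMap.smul_apply, smul_eq_mul]
      exact add_pos_of_nonneg_of_pos (hnn v) (mul_pos hε (hCpos v hv))
  have hcont : Continuous f :=
    (continuous_twoPow_apply (finrank ℂ V) F).comp (continuous_const.add (continuous_id.smul continuous_const))
  have hclosed : IsClosed {ε : ℝ | 0 ≤ f ε} := isClosed_le continuous_const hcont
  have hsub : Set.Ioi (0 : ℝ) ⊆ {ε : ℝ | 0 ≤ f ε} := fun ε hε ↦ (hfpos ε hε).le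
  have h0 : (0 : ℝ) ∈ {ε : ℝ | 0 ≤ f ε} := by
    apply hclosed.closure_subset_iff.2 hsub
    rw [closure_Ioi]
    exact Set.self_mem_Ici
  have hf0 : f 0 = A.twoPow (finrank ℂ V) F := by
    simp only [hf, zero_smul, add_zero]
  have := h0
  rw [Set.mem_setOf_eq, hf0] at this
  exact this

end TwoForm

/-! ## On a compact complex manifold: `∫_M θⁿ > 0` for a semi-positive `(1,1)`-form positive at one point -/

section Integral

open scoped Manifold ContDiff
open Literature.NumberTheory.Transcendental TwoForm

variable {E : Type*} [NormedAddCommGroup E] [NormedSpace ℂ E] [FiniteDimensional ℂ E]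
  {M : Type*} [TopologicalSpace M] [ChartedSpace E M] [IsManifold 𝓘(ℂ, E) ω M]
  [IsManifold 𝓘(ℝ, E) ∞ M] [T2Space M] [CompactSpace M]

/-- **`0 < ∫_M θⁿ` for a smooth semi-positive `(1,1)`-form which is positive at one point** of a
compact complex manifold of dimension `n` (modelled on `E`, `n = dim_ℂ E`), integrating against the
constant orientation `o₀ = [θⁿ_{x₀}]` of the model space (the complex orientation): pointwise
`θⁿ_x = c(x) θⁿ_{x₀}` with `c(x) ≥ 0` (`twoPow_apply_basisFrame_nonneg`, tested on the frame of a
fixed complex basis, against the positive `(1,1)`-covector `θ_{x₀}`; `c(x₀) = 1 > 0`,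
`twoPow_apply_basisFrame_pos`), so every chart integrand is `≥ 0`, `> 0` near `x₀`
(`MForm.integral_pos_of_sign_mul_apply_nonneg`, Lee Prop. 16.6 (c)). This is the computation of the
volume of a complex submanifold / the Wirtinger inequality in the form "the pull-back of a Kähler form
under a holomorphic map which is immersive at one point has positive top integral" (Voisin I §3.1.3,
Lemma 3.8 and p. 64; Griffiths–Harris Ch. 0 §2). [cite: VoisinHodgeI2002, §3.1.3 Lemma 3.8]
[cite: LeeSmoothManifolds2013, Prop. 16.6] -/
theorem exists_orientation_integral_twoFormPow_pos [MeasurableSpace E] [BorelSpace E]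
    [Fact (finrank ℝ E = 2 * finrank ℂ E)] {θ : MForm 𝓘(ℝ, E) M ℝ 2} (hθ : IsSmoothForm θ)
    (hJ : ∀ (x : M) (v w : E), (show E [⋀^Fin 2]→L[ℝ] ℝ from θ x) ![Complex.I • v, Complex.I • w] =
      (show E [⋀^Fin 2]→L[ℝ] ℝ from θ x) ![v, w])
    (hnn : ∀ (x : M) (v : E), 0 ≤ (show E [⋀^Fin 2]→L[ℝ] ℝ from θ x) ![v, Complex.I • v])
    {x₀ : M} (hpos : ∀ v : E, v ≠ 0 → 0 < (show E [⋀^Fin 2]→L[ℝ] ℝ from θ x₀) ![v, Complex.I • v]) :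
    ∃ o₀ : Orientation ℝ E (Fin (2 * finrank ℂ E)),
      IsContinuousOrientation (I := 𝓘(ℝ, E)) (M := M) (fun _ ↦ o₀) ∧
        0 < (MForm.twoFormPow 𝓘(ℝ, E) M θ (finrank ℂ E)).integral (fun _ : M ↦ o₀) := by
  classical
  haveI : WedgeFacts 𝓘(ℝ, E) M ℝ :=
    wedgeFacts_of_assoc 𝓘(ℝ, E) M ℝ (ContinuousAlternatingMap.WedgeAssoc_holds ℝ E ℝ)
  -- notation: the top form `θⁿ`, read in the model space at each point
  set ωn : M → E [⋀^Fin (2 * finrank ℂ E)]→L[ℝ] ℝ :=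
    MForm.twoFormPow 𝓘(ℝ, E) M θ (finrank ℂ E) with hωn
  have hsmooth : IsSmoothForm (MForm.twoFormPow 𝓘(ℝ, E) M θ (finrank ℂ E)) :=
    isSmoothForm_twoFormPow hθ _
  have hωnx : ∀ x : M, ωn x = (show E [⋀^Fin 2]→L[ℝ] ℝ from θ x).twoPow (finrank ℂ E) := fun x ↦
    MForm.twoFormPow_apply θ (finrank ℂ E) x
  -- a fixed complex basis, its interleaved frame `F`: `θⁿ_x(F) ≥ 0` everywhere, `> 0` at `x₀`
  set e : Module.Basis (Fin (finrank ℂ E)) ℂ E := Module.finBasis ℂ E with he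
  obtain ⟨F, hF⟩ : ∃ F : Fin (2 * finrank ℂ E) → E, F = fun i : Fin (2 * finrank ℂ E) ↦
      if (i : ℕ) % 2 = 0 then e ⟨(i : ℕ) / 2, by omega⟩
        else Complex.I • e ⟨(i : ℕ) / 2, by omega⟩ := ⟨_, rfl⟩
  have hnnx : ∀ x : M, 0 ≤ ωn x F := fun x ↦ by
    rw [hωnx, hF]
    exact twoPow_apply_basisFrame_nonneg _ _ (hJ x) (hnn x) (hJ x₀) hpos e
  have hposx₀ : 0 < ωn x₀ F := by
    rw [hωnx, hF]
    exact twoPow_apply_basisFrame_pos _ (hJ x₀) hpos e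
  -- the reference top form `ψ₀ = θⁿ_{x₀}` and the reference real basis
  set ψ₀ : E [⋀^Fin (2 * finrank ℂ E)]→L[ℝ] ℝ := ωn x₀ with hψ₀
  set mb := modelBasis E (2 * finrank ℂ E) with hmb
  have hψF : 0 < ψ₀ F := hposx₀
  have hψne : ψ₀.toAlternatingMap ≠ 0 := fun h ↦ by
    have : ψ₀ F = 0 := by
      rw [← ContinuousAlternatingMap.coe_toAlternatingMap, h, AlternatingMap.zero_apply]
    exact hψF.ne' this
  have hψmb : ψ₀ mb ≠ 0 := fun h ↦ hψne (by
    rw [AlternatingMap.eq_smul_basis_det mb ψ₀.toAlternatingMap,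
      ContinuousAlternatingMap.coe_toAlternatingMap, h, zero_smul])
  -- top forms are multiples of `det_{mb}`: `w v = w(mb) · det_{mb}(v)`
  have hdetexp : ∀ (w : E [⋀^Fin (2 * finrank ℂ E)]→L[ℝ] ℝ) (v : Fin (2 * finrank ℂ E) → E),
      w v = w mb * mb.det v := fun w v ↦ by
    have h := congrArg (fun f : E [⋀^Fin (2 * finrank ℂ E)]→ₗ[ℝ] ℝ ↦ f v)
      (AlternatingMap.eq_smul_basis_det mb w.toAlternatingMap)
    simpa using h
  -- pointwise: `ωn x = c x • ψ₀` with `c x ≥ 0`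
  have hprop : ∀ x : M, ∃ c : ℝ, 0 ≤ c ∧ ∀ v, ωn x v = c * ψ₀ v := by
    intro x
    have hid : ∀ v, ωn x v = (ωn x mb / ψ₀ mb) * ψ₀ v := fun v ↦ by
      rw [hdetexp (ωn x) v, hdetexp ψ₀ v]
      field_simp
    refine ⟨ωn x mb / ψ₀ mb, ?_, hid⟩
    have h1 := hid F
    have hc : ωn x mb / ψ₀ mb = ωn x F / ψ₀ F := by
      rw [eq_div_iff hψF.ne', ← h1]
    rw [hc]
    exact div_nonneg (hnnx x) hψF.le
  -- the constant orientation `o₀ = [ψ₀]`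
  obtain ⟨o₀, ho₀⟩ : ∃ o₀ : Orientation ℝ E (Fin (2 * finrank ℂ E)),
      o₀ = rayOfNeZero ℝ _ hψne := ⟨_, rfl⟩
  have ho : IsContinuousOrientation (I := 𝓘(ℝ, E)) (M := M) (fun _ ↦ o₀) :=
    isContinuousOrientation_const o₀
  obtain ⟨r, hr, hrψ⟩ : ∃ r : ℝ, 0 < r ∧ o₀.someVector = r • ψ₀.toAlternatingMap :=
    ((ray_eq_iff (Module.Ray.someVector_ne_zero o₀) hψne).1
      (by rw [Module.Ray.someVector_ray, ho₀])).exists_pos_right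
        (Module.Ray.someVector_ne_zero o₀) hψne
  have hsign : Real.sign (o₀.someVector mb) = Real.sign (ψ₀ mb) := by
    rw [hrψ, AlternatingMap.smul_apply, ContinuousAlternatingMap.coe_toAlternatingMap, smul_eq_mul,
      real_sign_mul, Real.sign_of_pos hr, one_mul]
  -- the integrand `sign(o₀(mb)) · θⁿ_x(mb) = c(x) |ψ₀(mb)|`
  have hval : ∀ x : M, ∃ c : ℝ, 0 ≤ c ∧
      Real.sign (o₀.someVector mb) * ωn x mb = c * |ψ₀ mb| := by
    intro x
    obtain ⟨c, hc, hcv⟩ := hprop x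
    refine ⟨c, hc, ?_⟩
    rw [hsign, hcv mb, ← real_sign_mul_self (ψ₀ mb)]
    ring
  refine ⟨o₀, ho, MForm.integral_pos_of_sign_mul_apply_nonneg ho hsmooth (fun x ↦ ?_) ⟨x₀, ?_⟩⟩
  · obtain ⟨c, hc, hcx⟩ := hval x
    show 0 ≤ Real.sign (o₀.someVector mb) * ωn x mb
    rw [hcx]
    exact mul_nonneg hc (abs_nonneg _)
  · show 0 < Real.sign (o₀.someVector mb) * ωn x₀ mb
    rw [hsign]
    change 0 < Real.sign (ψ₀ mb) * ψ₀ mb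
    rw [real_sign_mul_self]
    exact abs_pos.2 hψmb

/-- **Hence `θⁿ` is not exact, and neither is any closed smooth form cohomologous data built on it**:
under the hypotheses of `exists_orientation_integral_twoFormPow_pos` (θ smooth, semi-positive
`(1,1)`, positive at one point of the non-empty compact complex `n`-fold `M`), `θⁿ ∉ B^{2n}(M)` —
exact forms integrate to zero by Stokes (`MForm.integral_eq_zero_of_mem_exactSmoothForms_holds`).
In particular the de Rham class `[θⁿ] = [θ]ⁿ ∈ H^{2n}_dR(M)` is non-zero when `θ` is closed.
[cite: VoisinHodgeI2002, §3.1.3 Cor. 3.9] [cite: LeeSmoothManifolds2013, Cor. 16.13] -/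
theorem twoFormPow_finrank_not_mem_exactSmoothForms {θ : MForm 𝓘(ℝ, E) M ℝ 2} (hθ : IsSmoothForm θ)
    (hJ : ∀ (x : M) (v w : E), (show E [⋀^Fin 2]→L[ℝ] ℝ from θ x) ![Complex.I • v, Complex.I • w] =
      (show E [⋀^Fin 2]→L[ℝ] ℝ from θ x) ![v, w])
    (hnn : ∀ (x : M) (v : E), 0 ≤ (show E [⋀^Fin 2]→L[ℝ] ℝ from θ x) ![v, Complex.I • v])
    {x₀ : M} (hpos : ∀ v : E, v ≠ 0 → 0 < (show E [⋀^Fin 2]→L[ℝ] ℝ from θ x₀) ![v, Complex.I • v]) :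
    MForm.twoFormPow 𝓘(ℝ, E) M θ (finrank ℂ E) ∉ exactSmoothForms 𝓘(ℝ, E) M ℝ (2 * finrank ℂ E) := by
  intro hex
  letI : MeasurableSpace E := borel E
  haveI : BorelSpace E := ⟨rfl⟩
  haveI : Fact (finrank ℝ E = 2 * finrank ℂ E) := ⟨finrank_real_of_complex E⟩
  obtain ⟨o₀, ho, hpos'⟩ := exists_orientation_integral_twoFormPow_pos hθ hJ hnn hpos
  exact hpos'.ne' (MForm.integral_eq_zero_of_mem_exactSmoothForms_holds (o := fun _ : M ↦ o₀) ho hex)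

end Integral

end Literature.Geometry.Kaehler

end
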